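import Literature.MathematicalPhysics.QuantumFieldTheory.OSDistributionSpaceTimeGroup
import Literature.Analysis.UnboundedOperators.UnitaryGroupGenerator
import Mathlib.Analysis.SpecialFunctions.Integrals.Basic
import Mathlib.MeasureTheory.Integral.Prod
import HarnessLib

/-!
# Positivity of the OS Hamiltonian: `H ≥ 0` for `V(s) = e^{isH}`

Osterwalder–Schrader I (CMP 31 (1973)), §4.1, p. 92: "Let `H` be the infinitesimal generator of
`T^t`. It is a positive self-adjoint operator on `ℋ`". For the unitary time group
`V(s) = timeGroupOp hE1 s` (`OSDistributionSpaceTimeGroup`) we prove positivity of its Stone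
generator in the tree's sense `UnitaryRep.HasPositiveEnergy` (`0 ≤ ⟪x, H x⟫` on `D(H)`, with
`V(s) = e^{isH}`), by the tree's mollifier criterion `UnitaryRep.hasPositiveEnergy_of_dense`:
it suffices that `0 ≤ Im ⟪∫₀ᵗ V(s) x ds, V(t) x − x⟫` for all `x` and `t > 0`. With
`m(u) = ⟪x, V(u) x⟫ = ∫ λ^{−iu} dν_x(λ)` (the spectral measure `ν_x` of `e^{-H}`, carried by `[0, 1]`),

  `⟪∫₀ᵗ V(s) x ds, V(t) x − x⟫ = ∫₀ᵗ m(u) du − conj ∫₀ᵗ m(u) du`,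

so its imaginary part is `2 ∫₀ᵗ Im m(u) du = 2 ∫ (∫₀ᵗ −sin(u log λ) du) dν_x(λ)
= 2 ∫ (1 − cos(t log λ))/(−log λ) dν_x(λ) ≥ 0` because `log λ ≤ 0` on `[0, 1]` — the elementary
shadow of `H = −log e^{-H} ≥ 0`.

* `inner_intervalIntegral_timeGroupOp` — the bracket in terms of `m`;
* `im_inner_timeGroupOp_self` — `Im ⟪x, V(u)x⟫ = ∫ −sin(u log λ) dν_x(λ)`;
* `intervalIntegral_neg_sin_mul_nonneg` — `0 ≤ ∫₀ᵗ −sin(u L) du` for `L ≤ 0`;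
* `hasPositiveEnergy_timeGroup` — **`H ≥ 0`**.

## References
* K. Osterwalder, R. Schrader, Axioms for Euclidean Green's functions, CMP 31 (1973), §4.1,
  p. 92 ("`H` … is a positive self-adjoint operator").
-/

noncomputable section

open MeasureTheory Set Filter intervalIntegral
open _root_.Topology
open scoped InnerProductSpace NNReal ComplexConjugate

-- CFC instance chain on `ℋ →L[ℂ] ℋ` (see `OSDistributionSpacePowers`).
set_option synthInstance.maxHeartbeats 200000

namespace Literature.MathematicalPhysics.QuantumFieldTheory

variable {d : ℕ} [NeZero d]

/-! ## Two generic integral lemmas -/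

/-- In a Hilbert space, `⟪∫ₐᵇ f, y⟫ = ∫ₐᵇ ⟪f s, y⟫` for continuous `f` and `a ≤ b`. [folklore] -/
theorem inner_intervalIntegral_left {E : Type*} [NormedAddCommGroup E] [InnerProductSpace ℂ E]
    [CompleteSpace E] {f : ℝ → E} (hf : Continuous f) (y : E) {a b : ℝ} (hab : a ≤ b) :
    ⟪∫ s in a..b, f s, y⟫_ℂ = ∫ s in a..b, ⟪f s, y⟫_ℂ := by
  have hfi : Integrable f (volume.restrict (Ioc a b)) :=
    (hf.integrableOn_Icc (μ := volume) (a := a) (b := b)).mono_set Ioc_subset_Icc_self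
  rw [integral_of_le hab, integral_of_le hab, ← inner_conj_symm, ← integral_inner hfi y,
    ← integral_conj]
  simp only [inner_conj_symm]

/-- `0 ≤ ∫₀ᵗ −sin(u L) du` for `L ≤ 0` and every real `t` (it equals `(1 − cos(tL))/(−L)` for
`L < 0`). [folklore] -/
theorem intervalIntegral_neg_sin_mul_nonneg {L : ℝ} (hL : L ≤ 0) (t : ℝ) :
    0 ≤ ∫ u in (0 : ℝ)..t, -Real.sin (u * L) := by
  rcases hL.eq_or_lt with rfl | hL'
  · simp
  · have hderiv : ∀ u ∈ uIcc (0 : ℝ) t,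
        HasDerivAt (fun u : ℝ => Real.cos (u * L) / L) (-Real.sin (u * L)) u := by
      intro u _
      have h := ((Real.hasDerivAt_cos (u * L)).comp u ((hasDerivAt_id u).mul_const L)).div_const L
      refine h.congr_deriv ?_
      rw [one_mul, mul_div_assoc, div_self hL'.ne, mul_one]
    have hint : IntervalIntegrable (fun u : ℝ => -Real.sin (u * L)) volume 0 t :=
      (Continuous.neg (by fun_prop)).intervalIntegrable 0 t
    rw [intervalIntegral.integral_eq_sub_of_hasDerivAt hderiv hint, zero_mul, Real.cos_zero,
      ← sub_div]
    exact div_nonneg_of_nonpos (by linarith [Real.cos_le_one (t * L)]) hL'.le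

section SchwingerFamily
open Literature.MathematicalPhysics.QuantumLattice (SchwingerFamily)
open Literature.MathematicalPhysics.QuantumLattice.SchwingerFamily
open Literature.MathematicalPhysics.QuantumLattice.SchwingerFamily.OSSpace
open Literature.Analysis.OperatorTheory
open Literature.Analysis.UnboundedOperators

variable {𝔖 : SchwingerFamily (EuclideanSpace ℝ (Fin d))} {hE2 : 𝔖.IsOSReflectionPositive}

/-! ## The mollifier bracket in terms of `m(u) = ⟪x, V(u) x⟫` -/

/-- `u ↦ ⟪x, V(u) x⟫` is continuous. [folklore] -/
theorem _root_.Literature.MathematicalPhysics.QuantumLattice.SchwingerFamily.OSSpace.continuous_inner_timeGroupOp_self (hE1 : 𝔖.IsEuclideanCovariant) (x : OSHilbert 𝔖 hE2) :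
    Continuous fun u : ℝ => ⟪x, timeGroupOp (hE2 := hE2) hE1 u x⟫_ℂ :=
  continuous_const.inner (continuous_timeGroupOp_apply hE1 x)

/-- `⟪x, V(−u) x⟫ = conj ⟪x, V(u) x⟫`. [folklore] -/
theorem _root_.Literature.MathematicalPhysics.QuantumLattice.SchwingerFamily.OSSpace.inner_timeGroupOp_self_neg (hE1 : 𝔖.IsEuclideanCovariant) (u : ℝ) (x : OSHilbert 𝔖 hE2) :
    ⟪x, timeGroupOp (hE2 := hE2) hE1 (-u) x⟫_ℂ = conj ⟪x, timeGroupOp hE1 u x⟫_ℂ := by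
  rw [← inner_timeGroupOp_left hE1 u x x, inner_conj_symm]

/-- `⟪V(s) x, V(t) x − x⟫ = m(t − s) − conj m(s)` with `m(u) = ⟪x, V(u) x⟫`. [folklore] -/
theorem _root_.Literature.MathematicalPhysics.QuantumLattice.SchwingerFamily.OSSpace.inner_timeGroupOp_sub (hE1 : 𝔖.IsEuclideanCovariant) (s t : ℝ) (x : OSHilbert 𝔖 hE2) :
    ⟪timeGroupOp (hE2 := hE2) hE1 s x, timeGroupOp hE1 t x - x⟫_ℂ =
      ⟪x, timeGroupOp hE1 (t - s) x⟫_ℂ - conj ⟪x, timeGroupOp hE1 s x⟫_ℂ := by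
  rw [inner_sub_right, inner_timeGroupOp_timeGroupOp hE1, ← inner_timeGroupOp_self_neg hE1,
    inner_timeGroupOp_left hE1]

/-- **The mollifier bracket**: for `t ≥ 0`,
`⟪∫₀ᵗ V(s) x ds, V(t) x − x⟫ = ∫₀ᵗ ⟪x, V(u) x⟫ du − conj ∫₀ᵗ ⟪x, V(u) x⟫ du`. [folklore] -/
theorem _root_.Literature.MathematicalPhysics.QuantumLattice.SchwingerFamily.OSSpace.inner_intervalIntegral_timeGroupOp (hE1 : 𝔖.IsEuclideanCovariant) (x : OSHilbert 𝔖 hE2) {t : ℝ} (ht : 0 ≤ t) :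
    ⟪∫ s in (0 : ℝ)..t, timeGroupOp (hE2 := hE2) hE1 s x, timeGroupOp hE1 t x - x⟫_ℂ =
      (∫ u in (0 : ℝ)..t, ⟪x, timeGroupOp hE1 u x⟫_ℂ) - conj (∫ u in (0 : ℝ)..t, ⟪x, timeGroupOp hE1 u x⟫_ℂ) := by
  have hm := continuous_inner_timeGroupOp_self (hE2 := hE2) hE1 x
  rw [inner_intervalIntegral_left (continuous_timeGroupOp_apply hE1 x) _ ht]
  simp only [inner_timeGroupOp_sub hE1]
  have hf : IntervalIntegrable (fun s : ℝ => ⟪x, timeGroupOp (hE2 := hE2) hE1 (t - s) x⟫_ℂ) volume 0 t :=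
    (hm.comp (continuous_const.sub continuous_id)).intervalIntegrable 0 t
  have hg : IntervalIntegrable (fun s : ℝ => conj ⟪x, timeGroupOp (hE2 := hE2) hE1 s x⟫_ℂ) volume 0 t :=
    (Complex.continuous_conj.comp hm).intervalIntegrable 0 t
  rw [intervalIntegral.integral_sub hf hg]
  congr 1
  · have := intervalIntegral.integral_comp_sub_left (fun u => ⟪x, timeGroupOp (hE2 := hE2) hE1 u x⟫_ℂ) t
      (a := 0) (b := t)
    simpa using this
  · rw [integral_of_le ht, integral_of_le ht, integral_conj]

/-- `Im (z − conj z) = 2 Im z`. [folklore] -/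
theorem im_sub_conj (z : ℂ) : (z - conj z).im = 2 * z.im := by
  simp [Complex.sub_im, Complex.conj_im]; ring

/-! ## `Im ⟪x, V(u) x⟫` through the spectral measure -/

/-- Pointwise: `Im (λ^{−iu}) = −sin(u log λ)` for real `λ ≥ 0` (`0^{−iu} = 0` for `u ≠ 0`,
`log 0 = 0`). [folklore] -/
theorem im_ofReal_cpow_neg_I_mul {r : ℝ} (hr : 0 ≤ r) (u : ℝ) :
    ((r : ℂ) ^ (-(Complex.I * u) : ℂ)).im = -Real.sin (u * Real.log r) := by
  rcases hr.eq_or_lt with rfl | hr'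
  · simp only [Complex.ofReal_zero, Real.log_zero, mul_zero, Real.sin_zero, neg_zero]
    by_cases hu : u = 0
    · subst hu; simp
    · rw [Complex.zero_cpow (by simp [hu]), Complex.zero_im]
  · rw [Complex.cpow_def_of_ne_zero (Complex.ofReal_ne_zero.2 hr'.ne'), ← Complex.ofReal_log hr'.le,
      Complex.exp_im]
    simp [mul_comm]

/-- **`Im ⟪x, V(u) x⟫ = ∫ −sin(u log λ) dν_x(λ)`** (from `⟪x, V(u)x⟫ = ∫ λ^{−iu} dν_x`). [folklore] -/
theorem _root_.Literature.MathematicalPhysics.QuantumLattice.SchwingerFamily.OSSpace.im_inner_timeGroupOp_self (hE1 : 𝔖.IsEuclideanCovariant) (u : ℝ) (x : OSHilbert 𝔖 hE2) :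
    (⟪x, timeGroupOp (hE2 := hE2) hE1 u x⟫_ℂ).im =
      ∫ r, -Real.sin (u * Real.log r) ∂(osSpectralMeasureReal hE1 x) := by
  rw [inner_timeGroupOp_self hE1 u x]
  have h := integral_im (integrable_ofReal_cpow (osSpectralMeasureReal_ae_mem_Icc hE1 x)
    (re_neg_I_mul_nonneg u))
  simp only [RCLike.im_to_complex] at h
  rw [← h]
  refine integral_congr_ae ((osSpectralMeasureReal_ae_mem_Icc hE1 x).mono fun r hr => ?_)
  exact im_ofReal_cpow_neg_I_mul hr.1 u

/-! ## Positivity -/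

/-- **`0 ≤ Im ∫₀ᵗ ⟪x, V(u) x⟫ du`** for `t ≥ 0`: Fubini and `∫₀ᵗ −sin(u log λ) du ≥ 0` for
`λ ∈ [0, 1]`. [folklore] -/
theorem _root_.Literature.MathematicalPhysics.QuantumLattice.SchwingerFamily.OSSpace.im_intervalIntegral_inner_timeGroupOp_nonneg (hE1 : 𝔖.IsEuclideanCovariant) (x : OSHilbert 𝔖 hE2) {t : ℝ} (ht : 0 ≤ t) :
    0 ≤ (∫ u in (0 : ℝ)..t, ⟪x, timeGroupOp (hE2 := hE2) hE1 u x⟫_ℂ).im := by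
  set ν := osSpectralMeasureReal hE1 x with hν
  have hm := continuous_inner_timeGroupOp_self (hE2 := hE2) hE1 x
  -- `Im` commutes with the `u`-integral
  have h1 : (∫ u in (0 : ℝ)..t, ⟪x, timeGroupOp (hE2 := hE2) hE1 u x⟫_ℂ).im =
      ∫ u in (0 : ℝ)..t, (⟪x, timeGroupOp (hE2 := hE2) hE1 u x⟫_ℂ).im := by
    rw [integral_of_le ht, integral_of_le ht]
    have h := integral_im (((hm.integrableOn_Icc (μ := volume) (a := 0) (b := t)).mono_set Ioc_subset_Icc_self))
    simp only [RCLike.im_to_complex] at h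
    exact h.symm
  rw [h1]
  simp only [im_inner_timeGroupOp_self hE1]
  -- Fubini on `Ioc 0 t × ℝ`
  have hF : Integrable (Function.uncurry fun (u : ℝ) (r : ℝ) => -Real.sin (u * Real.log r))
      ((volume.restrict (Ioc (0 : ℝ) t)).prod ν) := by
    refine Integrable.of_bound ?_ 1 (Eventually.of_forall fun p => ?_)
    · exact (Measurable.neg ((measurable_fst.mul (Real.measurable_log.comp measurable_snd)).sin)).aestronglyMeasurable
    · obtain ⟨u, r⟩ := p
      simp only [Function.uncurry_apply_pair, norm_neg, Real.norm_eq_abs]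
      exact Real.abs_sin_le_one _
  rw [integral_of_le ht, integral_integral_swap hF]
  -- pointwise nonnegativity of the inner integral, `ν`-a.e. (`log r ≤ 0` on `[0, 1]`)
  refine integral_nonneg_of_ae ((osSpectralMeasureReal_ae_mem_Icc hE1 x).mono fun r hr => ?_)
  have hlog : Real.log r ≤ 0 := Real.log_nonpos hr.1 hr.2
  simp only [Pi.zero_apply]
  rw [← integral_of_le ht]
  exact intervalIntegral_neg_sin_mul_nonneg hlog t

/-- **The OS Hamiltonian is positive**: the Stone generator `H` of the unitary time group
`V(s) = e^{isH}` on the OS Hilbert space satisfies `0 ≤ ⟪x, H x⟫` on its domain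
(Osterwalder–Schrader I (1973), §4.1, p. 92: "`H` … is a positive self-adjoint operator";
here through the tree's mollifier criterion `UnitaryRep.hasPositiveEnergy_of_dense` and the
spectral measure of `e^{-H}`). [cite: OsterwalderSchraderCMP1973, §4.1 p. 92] -/
theorem _root_.Literature.MathematicalPhysics.QuantumLattice.SchwingerFamily.OSSpace.hasPositiveEnergy_timeGroup (hE1 : 𝔖.IsEuclideanCovariant) :
    (timeGroup (hE2 := hE2) hE1).HasPositiveEnergy := by
  refine UnitaryRep.hasPositiveEnergy_of_dense _ dense_univ fun x _ t ht => ?_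
  simp only [timeGroup_appReal]
  rw [inner_intervalIntegral_timeGroupOp hE1 x ht.le, im_sub_conj]
  exact mul_nonneg zero_le_two (im_intervalIntegral_inner_timeGroupOp_nonneg hE1 x ht.le)

end SchwingerFamily

end Literature.MathematicalPhysics.QuantumFieldTheory
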